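import Literature.Barriers.RiemannHypothesis.BohrDenseValuesProofs
import Literature.NumberTheory.LFunctions.ZetaEulerProductMeanSquareUniformProofs
import Literature.NumberTheory.LFunctions.ZetaUniversalityDiscTools
import Literature.NumberTheory.LFunctions.EulerProductRobustTarget
import Mathlib.MeasureTheory.Integral.Prod
import Mathlib.Analysis.SpecialFunctions.Complex.Circle
import HarnessLib

/-!
# `a`-points of `ζ` in every strip `1/2 < α < Re s < β < 1` beyond every height; `BohrDenseValues_holds`

Sibling of `Literature/Barriers/RiemannHypothesis/BohrDenseValues.lean` (barrier `BohrDenseValues`)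
and of `BohrDenseValuesProofs.lean` (conjuncts 1–2 proved, `BohrDenseValues_of_exists_aPoint`).
This file proves conjunct 3 unconditionally, following Titchmarsh's proof of Theorem 11.10
(*The Theory of the Riemann Zeta-Function*, §11.10) in multiplicative form for `ζ` itself:

* `exists_shift_near_eulerProduct_on_disc` — **vertical shifts of `ζ` approximate every finite
  Euler product on discs** (the two-dimensional Bohr–Courant mechanism; Titchmarsh §11.10,
  p. 304, Steuding §1.3 (1.18)–(1.26)): for a closed disc `|s - σ₀| ≤ ρ` with
  `1/2 < σ₀ - 2ρ`, `σ₀ + 2ρ < 1`, every `κ > 0`, `K ≥ 0`, all large `M`, all unimodular `b_p`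
  with `|∏_{p<M}(1 - b_p p^{-s})⁻¹| ≤ K` on the disc and every height, there is `t` beyond it with
  `|ζ(s+it) - ∏_{p<M}(1 - b_p p^{-s})⁻¹| ≤ κ` on the disc. Ingredients: the torus
  `(ℝ/ℤ)^{primes<P}` and its Kronecker flow (the tree's `KroneckerWeyl`), a bump localising the
  coordinates `p < M` (continuity radius uniform on the disc,
  `VoroninTools.exists_radius_forall_norm_sub_lt`), orthogonality of the tail
  `Σ_{M≤q<P} q^{-s}e(θ_q)` with complex coefficients on each point of the circle `|s-σ₀| = 2ρ`,
  the uniform mean square of `ζ - ∏_{p<P}` with shifts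
  (`zeta_sub_finiteEulerProduct_meanSquare_uniform_holds`), circle-to-disc
  (`VoroninTools.norm_sq_le_mul_integral_norm_sq_circle`) and the bookkeeping
  `VoroninTools.integral_bookkeeping`.
* `exists_aPoint_gt` — for `a ≠ 0`, `1/2 < α < β < 1` and every `T₀` there is `s` with
  `α < Re s < β`, `Im s > T₀`, `ζ(s) = a`: the robust target `G` of
  `Literature.NumberTheory.LFunctions.exists_robustTarget` (`G(σ₀) = a` exactly, `G ≢ a`) gives a
  circle `|s - σ₀| = ρ` with `m = min |G - a| > 0`; a truncation `∏_{p<M'}(1 - b_p p^{-s})⁻¹` within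
  `m/4` of `G`; a shift `t` with `ζ(· + it)` within `m/4` of the truncation; Rouché
  (`exists_zero_of_norm_sub_lt_norm`).
* `BohrDenseValues_holds : BohrDenseValues` — the barrier, unconditionally
  (`BohrDenseValues_of_exists_aPoint`).

## References

* [Titchmarsh1986] E. C. Titchmarsh, *The Theory of the Riemann Zeta-Function*, 2nd ed. (rev.
  D. R. Heath-Brown), Oxford 1986, §11.9 (proof of Thm. 11.9) and §11.10 (proof of Thm. 11.10 and
  its corollary).
* [Steuding2007] J. Steuding, *Value-Distribution of L-Functions*, LNM 1877, Springer 2007, §1.3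
  (1.18)–(1.26).
-/

noncomputable section

open Complex Filter Topology Set MeasureTheory Metric Finset
open Literature.NumberTheory.DiophantineApproximation Literature.NumberTheory.LFunctions

namespace Literature.Barriers.RiemannHypothesis

namespace ShiftsOnDiscs

/-! ### Characters, phases and prime powers -/

/-- Every unimodular complex number is `e(x)` for some `x ∈ ℝ/ℤ`. [folklore] -/
theorem exists_fourier_one_eq {u : ℂ} (hu : ‖u‖ = 1) : ∃ x : UnitAddCircle, fourier 1 x = u := by
  refine ⟨((Complex.arg u / (2 * Real.pi) : ℝ) : UnitAddCircle), ?_⟩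
  rw [BohrCourant.fourier_one_coe]
  have : 2 * Real.pi * I * ((Complex.arg u / (2 * Real.pi) : ℝ) : ℂ) = Complex.arg u * I := by
    push_cast; field_simp
  rw [this]
  have h := Complex.norm_mul_exp_arg_mul_I u
  rw [hu, Complex.ofReal_one, one_mul] at h
  exact h

/-- `n^{-(s+it)} = n^{-s} · n^{-it}` (`n ≥ 1`). [folklore] -/
theorem natCast_cpow_neg_add_mul_I {n : ℕ} (hn : n ≠ 0) (s : ℂ) (t : ℝ) :
    (n : ℂ) ^ (-(s + t * I)) = (n : ℂ) ^ (-s) * (n : ℂ) ^ (-((t : ℂ) * I)) := by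
  have hn' : (n : ℂ) ≠ 0 := by exact_mod_cast hn
  rw [neg_add, Complex.cpow_add _ _ hn']

/-- `M.primesBelow` is the set of primes `< M`. [folklore] -/
theorem primesBelow_eq_filter_range (M : ℕ) :
    M.primesBelow = (Finset.range M).filter Nat.Prime := rfl

/-! ### Orthogonality with complex coefficients -/

/-- **Mean square of a trigonometric sum with complex coefficients against a weight in the other
variables.** If the continuous weight `φ` does not depend on the coordinates `j ∈ S`, then
`∫ φ(θ) |Σ_{j∈S} c_j e(θ_j)|² dθ = (Σ_{j∈S} |c_j|²) ∫ φ dθ` (complex `c_j`; the cross terms vanish by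
`KroneckerWeyl.integral_mul_fourier_apply_eq_zero`). [folklore] -/
theorem integral_mul_norm_sq_sum_fourier_complex {ι : Type*} [Fintype ι] [DecidableEq ι]
    (S : Finset ι) (c : ι → ℂ) {φ : UnitAddTorus ι → ℝ} (hφc : Continuous φ)
    (hφ : ∀ j ∈ S, ∀ (x : UnitAddTorus ι) (a : UnitAddCircle), φ (x + Pi.single j a) = φ x) :
    ∫ x : UnitAddTorus ι, φ x * ‖∑ j ∈ S, c j * fourier 1 (x j)‖ ^ 2 =
      (∑ j ∈ S, ‖c j‖ ^ 2) * ∫ x : UnitAddTorus ι, φ x := by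
  -- pass to complex integrals
  apply Complex.ofReal_injective
  rw [← integral_complex_ofReal, Complex.ofReal_mul, ← integral_complex_ofReal]
  push_cast
  -- `|w|² = conj w * w` and expand
  have hconj : ∀ x : UnitAddTorus ι, (starRingEnd ℂ) (∑ j ∈ S, c j * fourier 1 (x j)) =
      ∑ j ∈ S, (starRingEnd ℂ) (c j) * fourier (-1) (x j) := by
    intro x
    rw [map_sum]
    refine Finset.sum_congr rfl fun j _ ↦ ?_
    rw [map_mul, fourier_neg]
  have hexp : ∀ x : UnitAddTorus ι,
      ((φ x : ℂ)) * ((‖∑ j ∈ S, c j * fourier 1 (x j)‖ : ℂ) ^ 2) =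
      ∑ j' ∈ S, ∑ j ∈ S, ((starRingEnd ℂ) (c j') * c j) *
        ((φ x : ℂ) * fourier (-1) (x j') * fourier 1 (x j)) := by
    intro x
    rw [← Complex.conj_mul', hconj, Finset.sum_mul_sum, Finset.mul_sum]
    refine Finset.sum_congr rfl fun j' _ ↦ ?_
    rw [Finset.mul_sum]
    refine Finset.sum_congr rfl fun j _ ↦ ?_
    ring
  simp_rw [hexp]
  -- integrate termwise
  have hint : ∀ j' j : ι, Integrable (fun x : UnitAddTorus ι ↦
      ((starRingEnd ℂ) (c j') * c j) * ((φ x : ℂ) * fourier (-1) (x j') * fourier 1 (x j))) := by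
    intro j' j
    refine KroneckerWeyl.integrable_of_continuous (Continuous.mul continuous_const ?_)
    exact ((Complex.continuous_ofReal.comp hφc).mul
      ((fourier (-1)).continuous.comp (continuous_apply j'))).mul
      ((fourier 1).continuous.comp (continuous_apply j))
  rw [integral_finsetSum _ fun j' _ ↦ integrable_finsetSum _ fun j _ ↦ hint j' j]
  simp_rw [integral_finsetSum _ fun j _ ↦ hint _ j, integral_const_mul]
  -- diagonal and off-diagonal terms
  have hterm : ∀ j' ∈ S, ∀ j ∈ S,
      ((starRingEnd ℂ) (c j') * c j) *
        ∫ x : UnitAddTorus ι, (φ x : ℂ) * fourier (-1) (x j') * fourier 1 (x j) =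
      if j = j' then ((‖c j‖ : ℂ) ^ 2) * ∫ x : UnitAddTorus ι, (φ x : ℂ) else 0 := by
    intro j' hj' j hj
    split_ifs with hjj
    · subst hjj
      have e : ∀ x : UnitAddTorus ι, (φ x : ℂ) * fourier (-1) (x j) * fourier 1 (x j) = φ x := by
        intro x
        rw [mul_assoc, ← fourier_add, neg_add_cancel, fourier_zero, mul_one]
      simp_rw [e]
      rw [Complex.conj_mul', ← Complex.ofReal_pow]
    · rw [KroneckerWeyl.integral_mul_fourier_apply_eq_zero (j := j) (m := 1) _ one_ne_zero,
        mul_zero]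
      intro x a
      rw [hφ j hj x a, Pi.add_apply, Pi.single_eq_of_ne (Ne.symm hjj), add_zero]
  rw [Finset.sum_congr rfl fun j' hj' ↦ Finset.sum_congr rfl fun j hj ↦ hterm j' hj' j hj]
  simp_rw [Finset.sum_ite_eq', Finset.sum_ite_mem, Finset.inter_self, ← Finset.sum_mul]

/-! ### Two Fubini swaps for continuous integrands -/

/-- **Fubini for a continuous bounded integrand on `torus × interval`:**
`∫_𝕋 ∫ₐᵇ F(θ, u) du dθ = ∫ₐᵇ ∫_𝕋 F(θ, u) dθ du`. [folklore] -/
theorem integral_torus_interval_swap {ι : Type*} [Fintype ι] {F : UnitAddTorus ι → ℝ → ℝ}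
    (hF : Continuous (Function.uncurry F)) {C : ℝ} (hC : ∀ θ u, ‖F θ u‖ ≤ C) {a b : ℝ}
    (hab : a ≤ b) :
    ∫ θ : UnitAddTorus ι, ∫ u in a..b, F θ u = ∫ u in a..b, ∫ θ : UnitAddTorus ι, F θ u := by
  have := KroneckerWeyl.isProbabilityMeasure_volume_unitAddTorus (ι := ι)
  simp_rw [intervalIntegral.integral_of_le hab]
  have hfin : IsFiniteMeasure ((volume : Measure (UnitAddTorus ι)).prod
      ((volume : Measure ℝ).restrict (Ioc a b))) := by
    have : IsFiniteMeasure ((volume : Measure ℝ).restrict (Ioc a b)) :=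
      ⟨by rw [Measure.restrict_apply_univ]; exact measure_Ioc_lt_top⟩
    infer_instance
  have hint : Integrable (Function.uncurry F) ((volume : Measure (UnitAddTorus ι)).prod
      ((volume : Measure ℝ).restrict (Ioc a b))) :=
    (integrable_const C).mono' hF.aestronglyMeasurable (ae_of_all _ fun p ↦ hC p.1 p.2)
  exact integral_integral_swap hint

/-- **Fubini for a continuous integrand on a product of intervals:**
`∫ₐᵇ ∫_c^d F(t, u) du dt = ∫_c^d ∫ₐᵇ F(t, u) dt du`. [folklore] -/
theorem integral_interval_interval_swap {F : ℝ → ℝ → ℝ} (hF : Continuous (Function.uncurry F))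
    {a b c d : ℝ} (hab : a ≤ b) (hcd : c ≤ d) :
    ∫ t in a..b, ∫ u in c..d, F t u = ∫ u in c..d, ∫ t in a..b, F t u := by
  simp_rw [intervalIntegral.integral_of_le hab, intervalIntegral.integral_of_le hcd]
  -- a bound on the compact rectangle
  obtain ⟨C, hC⟩ := (isCompact_Icc.prod isCompact_Icc : IsCompact (Icc a b ×ˢ Icc c d)).exists_bound_of_continuousOn
    hF.continuousOn
  have hfinb : IsFiniteMeasure ((volume : Measure ℝ).restrict (Ioc a b)) :=
    ⟨by rw [Measure.restrict_apply_univ]; exact measure_Ioc_lt_top⟩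
  have hfind : IsFiniteMeasure ((volume : Measure ℝ).restrict (Ioc c d)) :=
    ⟨by rw [Measure.restrict_apply_univ]; exact measure_Ioc_lt_top⟩
  have hint : Integrable (Function.uncurry F) (((volume : Measure ℝ).restrict (Ioc a b)).prod
      ((volume : Measure ℝ).restrict (Ioc c d))) := by
    refine (integrable_const C).mono' hF.aestronglyMeasurable ?_
    rw [Measure.prod_restrict, ae_restrict_iff' (measurableSet_Ioc.prod measurableSet_Ioc)]
    exact ae_of_all _ fun p hp ↦ hC p ⟨Ioc_subset_Icc_self hp.1, Ioc_subset_Icc_self hp.2⟩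
  exact integral_integral_swap hint

/-! ### The circle `|s - σ₀| = ρ'` in coordinates -/

/-- `circleMap σ₀ ρ' u + it = (σ₀ + ρ' cos u) + (t + ρ' sin u) i`. [folklore] -/
theorem circleMap_add_mul_I (σ₀ ρ' u t : ℝ) :
    circleMap (σ₀ : ℂ) ρ' u + t * I =
      ((σ₀ + ρ' * Real.cos u : ℝ) : ℂ) + ((t + ρ' * Real.sin u : ℝ) : ℂ) * I := by
  rw [circleMap, Complex.exp_mul_I]
  push_cast
  rw [← Complex.ofReal_cos, ← Complex.ofReal_sin]
  ring

/-- Points of the circle have real part in `[σ₀ - ρ', σ₀ + ρ']` and the shift `ρ' sin u` has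
`|ρ' sin u| ≤ ρ'` (`ρ' ≥ 0`). [folklore] -/
theorem circle_coords_mem {σ₀ ρ' : ℝ} (hρ' : 0 ≤ ρ') (u : ℝ) :
    σ₀ - ρ' ≤ σ₀ + ρ' * Real.cos u ∧ σ₀ + ρ' * Real.cos u ≤ σ₀ + ρ' ∧ |ρ' * Real.sin u| ≤ ρ' := by
  refine ⟨?_, ?_, ?_⟩
  · nlinarith [Real.neg_one_le_cos u]
  · nlinarith [Real.cos_le_one u]
  · rw [abs_mul, abs_of_nonneg hρ']
    exact mul_le_of_le_one_right hρ' (Real.abs_sin_le_one u)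


/-! ### Local factors on the torus -/

/-- The local factor `1 - e(x) n^{-s}` does not vanish for `n ≥ 2`, `Re s > 0`. [folklore] -/
theorem one_sub_fourier_mul_cpow_ne_zero {n : ℕ} (hn : 2 ≤ n) (x : UnitAddCircle) {s : ℂ}
    (hs : 0 < s.re) : (1 : ℂ) - fourier 1 x * (n : ℂ) ^ (-s) ≠ 0 := by
  intro h
  have h1 : ‖(fourier 1 x : ℂ) * (n : ℂ) ^ (-s)‖ < 1 := by
    rw [norm_mul, BohrCourant.norm_fourier_one, one_mul, Complex.norm_natCast_cpow_of_pos (by omega), neg_re]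
    exact Real.rpow_lt_one_of_one_lt_of_neg (by exact_mod_cast hn) (by linarith)
  rw [← sub_eq_zero.1 h, norm_one] at h1
  exact lt_irrefl _ h1

/-- Joint continuity of `(s, x) ↦ (1 - e(x) n^{-s})⁻¹` on `{Re s > 0} × (ℝ/ℤ)` (`n ≥ 2`). [folklore] -/
theorem continuousOn_localFactor {n : ℕ} (hn : 2 ≤ n) :
    ContinuousOn (fun p : ℂ × UnitAddCircle ↦ (1 - fourier 1 p.2 * (n : ℂ) ^ (-p.1))⁻¹)
      ({s : ℂ | 0 < s.re} ×ˢ univ) := by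
  intro p hp
  have hn0 : (n : ℂ) ≠ 0 := by exact_mod_cast (show n ≠ 0 by omega)
  have hc : ContinuousAt (fun p : ℂ × UnitAddCircle ↦ (1 : ℂ) - fourier 1 p.2 * (n : ℂ) ^ (-p.1)) p := by
    refine continuousAt_const.sub (ContinuousAt.mul ?_ ?_)
    · exact ((fourier 1).continuous.comp continuous_snd).continuousAt
    · exact (continuousAt_const_cpow hn0).comp (continuous_fst.neg).continuousAt
  exact (hc.inv₀ (one_sub_fourier_mul_cpow_ne_zero hn p.2 hp.1)).continuousWithinAt

end ShiftsOnDiscs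

set_option maxHeartbeats 1600000 in
open BohrCourant ShiftsOnDiscs VoroninTools KroneckerWeyl EulerProductMeanSquare FiniteEulerPhases in
/-- **Shifts of `ζ` approximate every finite Euler product on discs (Bohr–Courant on discs;
Titchmarsh §11.10, Steuding (1.18)–(1.26)).** Let `0 < ρ`, `1/2 < σ₀ - 2ρ`, `σ₀ + 2ρ < 1`,
`κ > 0`, `K ≥ 0`. There is `M₁` such that for every `M ≥ M₁`, every unimodular sequence `b_p`
with `|∏_{p<M} (1 - b_p p^{-s})⁻¹| ≤ K` on `|s - σ₀| ≤ ρ`, and every `T₀`, there is `t ≥ T₀` with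
`|ζ(s + it) - ∏_{p<M} (1 - b_p p^{-s})⁻¹| ≤ κ` for all `|s - σ₀| ≤ ρ`.
[cite: Titchmarsh1986, §11.10 (proof of Thm. 11.10)] [cite: Steuding2007, §1.3 (1.18)–(1.26)] -/
theorem exists_shift_near_eulerProduct_on_disc {σ₀ ρ : ℝ} (hρ : 0 < ρ) (hlo : 1 / 2 < σ₀ - 2 * ρ)
    (hhi : σ₀ + 2 * ρ < 1) {κ : ℝ} (hκ : 0 < κ) {K : ℝ} (hK : 0 ≤ K) :
    ∃ M₁ : ℕ, ∀ M : ℕ, M₁ ≤ M → ∀ b : ℕ → ℂ, (∀ p, ‖b p‖ = 1) →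
      (∀ s ∈ closedBall (σ₀ : ℂ) ρ, ‖∏ p ∈ M.primesBelow, (1 - b p * (p : ℂ) ^ (-s))⁻¹‖ ≤ K) →
      ∀ T₀ : ℝ, ∃ t : ℝ, T₀ ≤ t ∧ ∀ s ∈ closedBall (σ₀ : ℂ) ρ,
        ‖riemannZeta (s + t * I) - ∏ p ∈ M.primesBelow, (1 - b p * (p : ℂ) ^ (-s))⁻¹‖ ≤ κ := by
  classical
  -- Step 0: radii, abscissae, constants
  obtain ⟨ρ', hρ'⟩ : ∃ ρ' : ℝ, ρ' = 2 * ρ := ⟨_, rfl⟩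
  have hρρ' : ρ < ρ' := by rw [hρ']; linarith
  have hρ'0 : 0 < ρ' := by linarith
  obtain ⟨σ₁, hσ₁⟩ : ∃ σ₁ : ℝ, σ₁ = σ₀ - ρ' := ⟨_, rfl⟩
  have hσ₁h : 1 / 2 < σ₁ := by rw [hσ₁, hρ']; linarith
  have hσ₁0 : 0 < σ₁ := by linarith
  have hσ₂1 : σ₀ + ρ' < 1 := by rw [hρ']; linarith
  -- real parts and norms on the discs
  have hre_ball : ∀ w ∈ closedBall (σ₀ : ℂ) ρ', σ₁ ≤ w.re ∧ w.re ≤ σ₀ + ρ' := by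
    intro w hw
    rw [mem_closedBall, dist_eq_norm] at hw
    have h := (abs_re_le_norm (w - σ₀)).trans hw
    rw [sub_re, ofReal_re, abs_le] at h
    rw [hσ₁]; constructor <;> linarith [h.1, h.2]
  have hre_small : ∀ w ∈ closedBall (σ₀ : ℂ) ρ, σ₁ ≤ w.re ∧ w.re < 1 := by
    intro w hw
    have h := hre_ball w (closedBall_subset_closedBall hρρ'.le hw)
    exact ⟨h.1, by linarith [h.2]⟩
  -- the circle-to-disc constant `ρ'²/(2π(ρ'-ρ)²) = 2/π ≤ 1`
  have hCcirc : ρ' ^ 2 / (2 * Real.pi * (ρ' - ρ) ^ 2) ≤ 1 := by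
    rw [hρ', show 2 * ρ - ρ = ρ by ring, div_le_one (by positivity)]
    nlinarith [Real.pi_gt_three, sq_nonneg ρ]
  -- accuracies
  obtain ⟨κ₁, hκ₁⟩ : ∃ κ₁ : ℝ, κ₁ = κ / 4 := ⟨_, rfl⟩
  have hκ₁0 : 0 < κ₁ := by rw [hκ₁]; positivity
  obtain ⟨K', hK'⟩ : ∃ K' : ℝ, K' = K + κ + 1 := ⟨_, rfl⟩
  have hK'0 : 0 < K' := by rw [hK']; positivity
  obtain ⟨δ₁, hδ₁0, hδ₁s, hδ₁K⟩ : ∃ δ₁ : ℝ, 0 < δ₁ ∧ δ₁ ≤ 1 / 32 ∧ K' * (4 * δ₁) ≤ κ / 4 := by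
    refine ⟨min (1 / 32) (κ / (16 * K')), lt_min (by norm_num) (by positivity), min_le_left _ _, ?_⟩
    have h := min_le_right (1 / 32) (κ / (16 * K'))
    calc K' * (4 * min (1 / 32) (κ / (16 * K'))) ≤ K' * (4 * (κ / (16 * K'))) := by gcongr
      _ = κ / 4 := by field_simp; ring
  -- Step 1: the cut-off `M₁` (tail variance small)
  have eτ : ∀ᶠ M : ℕ in atTop, ∑' k : ℕ, ((k + M : ℕ) : ℝ) ^ (-(2 * σ₁)) <
      min δ₁ (δ₁ ^ 2 / (8 * Real.pi)) :=
    (tendsto_tsum_rpow_tail (σ := σ₁)).eventually_lt_const (lt_min hδ₁0 (by positivity))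
  obtain ⟨M₁, hM₁⟩ := eventually_atTop.1 (eτ.and (eventually_ge_atTop 4))
  refine ⟨M₁, fun M hM b hb hbound T₁ ↦ ?_⟩
  obtain ⟨hτM, hM4⟩ := hM₁ M hM
  obtain ⟨τ, hτ⟩ : ∃ τ : ℝ, τ = ∑' k : ℕ, ((k + M : ℕ) : ℝ) ^ (-(2 * σ₁)) := ⟨_, rfl⟩
  rw [← hτ] at hτM
  have hτδ₁ : τ < δ₁ := hτM.trans_le (min_le_left _ _)
  have hτδ₂ : τ < δ₁ ^ 2 / (8 * Real.pi) := hτM.trans_le (min_le_right _ _)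
  have hτ0 : 0 ≤ τ := by rw [hτ]; exact tsum_nonneg fun k ↦ by positivity
  -- Step 2: the target phases `θb` on the fixed torus `(ℝ/ℤ)^{primes<M}` and the head `F`
  obtain ⟨θb, hθb⟩ : ∃ θb : ↥(M.primesBelow) → UnitAddCircle, ∀ p, fourier 1 (θb p) = b p.1 :=
    ⟨fun p ↦ (exists_fourier_one_eq (hb p.1)).choose,
      fun p ↦ (exists_fourier_one_eq (hb p.1)).choose_spec⟩
  obtain ⟨F, hF⟩ : ∃ F : ℂ × (↥(M.primesBelow) → UnitAddCircle) → ℂ, F = fun q ↦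
      ∏ p : ↥(M.primesBelow), (1 - fourier 1 (q.2 p) * ((p.1 : ℕ) : ℂ) ^ (-q.1))⁻¹ := ⟨_, rfl⟩
  have hprime_M : ∀ p : ↥(M.primesBelow), (p.1).Prime := fun p ↦ Nat.prime_of_mem_primesBelow p.2
  have hFc : ContinuousOn F ({s : ℂ | 0 < s.re} ×ˢ univ) := by
    rw [hF]
    refine continuousOn_finsetProd _ fun p _ ↦ ?_
    have hn2 := (hprime_M p).two_le
    have hn0 : ((p.1 : ℕ) : ℂ) ≠ 0 := by exact_mod_cast (hprime_M p).ne_zero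
    intro q hq
    have hc : ContinuousAt (fun q : ℂ × (↥(M.primesBelow) → UnitAddCircle) ↦
        (1 : ℂ) - fourier 1 (q.2 p) * ((p.1 : ℕ) : ℂ) ^ (-q.1)) q := by
      refine continuousAt_const.sub (ContinuousAt.mul ?_ ?_)
      · exact ((fourier 1).continuous.comp ((continuous_apply p).comp continuous_snd)).continuousAt
      · exact (continuousAt_const_cpow hn0).comp continuous_fst.neg.continuousAt
    exact (hc.inv₀ (one_sub_fourier_mul_cpow_ne_zero hn2 _ hq.1)).continuousWithinAt
  have hFb : ∀ s : ℂ, F (s, θb) = ∏ p ∈ M.primesBelow, (1 - b p * (p : ℂ) ^ (-s))⁻¹ := by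
    intro s
    rw [hF]
    show ∏ p : ↥(M.primesBelow), (1 - fourier 1 (θb p) * ((p.1 : ℕ) : ℂ) ^ (-s))⁻¹ = _
    rw [← Finset.prod_coe_sort (M.primesBelow)]
    exact Finset.prod_congr rfl fun p _ ↦ by rw [hθb]
  -- the continuity radius `r ≤ 1` of the head, uniform on the disc
  have hKc : IsCompact (closedBall (σ₀ : ℂ) ρ) := isCompact_closedBall _ _
  have hsub0 : closedBall (σ₀ : ℂ) ρ ⊆ {s : ℂ | 0 < s.re} := fun s hs ↦
    show 0 < s.re by linarith [(hre_small s hs).1]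
  obtain ⟨r, hr0, hr1, hrad⟩ : ∃ r : ℝ, 0 < r ∧ r ≤ 1 ∧
      ∀ ϑ : ↥(M.primesBelow) → UnitAddCircle, dist ϑ θb < r →
        ∀ s ∈ closedBall (σ₀ : ℂ) ρ, ‖F (s, ϑ) - F (s, θb)‖ < κ₁ := by
    obtain ⟨r, hr0, h⟩ := exists_radius_forall_norm_sub_lt hKc
      (hFc.mono (Set.prod_mono hsub0 le_rfl)) hκ₁0 θb
    exact ⟨min r 1, lt_min hr0 one_pos, min_le_right _ _,
      fun ϑ hϑ s hs ↦ h ϑ (hϑ.trans_le (min_le_left _ _)) s hs⟩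
  -- Step 3: constants `c₁, δ₂, δ₃, ε'` and the mean-square input `P`, `T₀`
  obtain ⟨c₁, hc₁, hc₁0⟩ : ∃ c₁ : ℝ, c₁ = (r / 2) ^ M / 2 ∧ 0 < c₁ := ⟨_, rfl, by positivity⟩
  obtain ⟨δ₂, hδ₂⟩ : ∃ δ₂ : ℝ, δ₂ = δ₁ ^ 2 := ⟨_, rfl⟩
  have hδ₂0 : 0 < δ₂ := by rw [hδ₂]; positivity
  obtain ⟨δ₃, hδ₃⟩ : ∃ δ₃ : ℝ, δ₃ = (κ / 4) ^ 2 := ⟨_, rfl⟩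
  have hδ₃0 : 0 < δ₃ := by rw [hδ₃]; positivity
  obtain ⟨ε', hε'⟩ : ∃ ε' : ℝ, ε' = δ₃ * c₁ / (8 * Real.pi) := ⟨_, rfl⟩
  have hε'0 : 0 < ε' := by rw [hε']; positivity
  obtain ⟨P₀, hP₀⟩ := zeta_sub_finiteEulerProduct_meanSquare_uniform_holds σ₁ (σ₀ + ρ') ρ' ε'
    hσ₁h (by rw [hσ₁]; linarith) hσ₂1 hρ'0.le hε'0
  obtain ⟨P, hMP, hP₀P⟩ : ∃ P : ℕ, M ≤ P ∧ P₀ ≤ P := ⟨max M P₀, le_max_left _ _, le_max_right _ _⟩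
  obtain ⟨T₀, hT₀⟩ := hP₀ P hP₀P
  clear hP₀
  -- Step 4: the torus `(ℝ/ℤ)^{primes<P}`, its flow, and the functions on it
  obtain ⟨l, hl⟩ : ∃ l : ↥(P.primesBelow) → ℝ, l = fun q ↦ -Real.log q.1 / (2 * Real.pi) :=
    ⟨_, rfl⟩
  have hlin : LinearIndependent ℤ l := by
    rw [hl]; exact linearIndependent_neg_log_prime_div _ fun p hp ↦ Nat.prime_of_mem_primesBelow hp
  obtain ⟨πM, hπM⟩ : ∃ πM : UnitAddTorus ↥(P.primesBelow) → (↥(M.primesBelow) → UnitAddCircle),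
      πM = fun θ p ↦ θ ⟨p.1, mem_primesBelow_of_le hMP p.2⟩ := ⟨_, rfl⟩
  have hπMc : Continuous πM := by
    rw [hπM]; exact continuous_pi fun p ↦ continuous_apply _
  obtain ⟨S, hS⟩ : ∃ S : Finset ↥(P.primesBelow), S = Finset.univ.filter (fun q ↦ M ≤ q.1) :=
    ⟨_, rfl⟩
  obtain ⟨Zt, hZt⟩ : ∃ Zt : UnitAddTorus ↥(P.primesBelow) → ℂ → ℂ, Zt = fun θ s ↦ F (s, πM θ) :=
    ⟨_, rfl⟩
  obtain ⟨Lt, hLt⟩ : ∃ Lt : UnitAddTorus ↥(P.primesBelow) → ℂ → ℂ, Lt = fun θ s ↦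
      ∑ q ∈ S, fourier 1 (θ q) * ((q.1 : ℕ) : ℂ) ^ (-s) := ⟨_, rfl⟩
  obtain ⟨Qt, hQt⟩ : ∃ Qt : UnitAddTorus ↥(P.primesBelow) → ℂ → ℂ, Qt = fun θ s ↦
      ∏ q ∈ S, (1 - fourier 1 (θ q) * ((q.1 : ℕ) : ℂ) ^ (-s))⁻¹ := ⟨_, rfl⟩
  obtain ⟨φt, hφt⟩ : ∃ φt : UnitAddTorus ↥(P.primesBelow) → ℝ, φt = fun θ ↦
      max 0 (1 - 2 * dist (πM θ) θb / r) := ⟨_, rfl⟩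
  obtain ⟨flow, hflow⟩ : ∃ flow : ℝ → UnitAddTorus ↥(P.primesBelow), flow = fun t q ↦
      ((t * l q : ℝ) : UnitAddCircle) := ⟨_, rfl⟩
  have hflowc : Continuous flow := by rw [hflow]; exact continuous_flow l
  -- the Euler product along the flow splits as head · tail
  have hcoordS : ∀ (t : ℝ) (q : ↥(P.primesBelow)),
      flow t q = (((t * (-Real.log q.1 / (2 * Real.pi))) : ℝ) : UnitAddCircle) := by
    intro t q; rw [hflow, hl]
  have hcoordM : ∀ (t : ℝ) (p : ↥(M.primesBelow)),
      πM (flow t) p = (((t * (-Real.log p.1 / (2 * Real.pi))) : ℝ) : UnitAddCircle) := by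
    intro t p; rw [hπM, hflow, hl]
  have hEuler : ∀ (t : ℝ) (s : ℂ), ∏ p ∈ P.primesBelow, (1 - (p : ℂ) ^ (-(s + t * I)))⁻¹ =
      Zt (flow t) s * Qt (flow t) s := by
    intro t s
    obtain ⟨g, hg⟩ : ∃ g : ℕ → ℂ, g = fun n : ℕ ↦
        (1 - fourier 1 ((((t * (-Real.log (n : ℝ) / (2 * Real.pi))) : ℝ)) : UnitAddCircle) *
          ((n : ℕ) : ℂ) ^ (-s))⁻¹ := ⟨_, rfl⟩
    have hg' : ∀ n : ℕ, n ≠ 0 → (1 - (n : ℂ) ^ (-(s + t * I)))⁻¹ = g n := by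
      intro n hn
      rw [hg]
      show _ = (1 - fourier 1 ((((t * (-Real.log n / (2 * Real.pi))) : ℝ)) : UnitAddCircle) *
          ((n : ℕ) : ℂ) ^ (-s))⁻¹
      rw [fourier_one_flow_eq_cpow hn, natCast_cpow_neg_add_mul_I hn, mul_comm]
    have h1 : Zt (flow t) s = ∏ n ∈ M.primesBelow, g n := by
      rw [hZt, hF]
      show ∏ p : ↥(M.primesBelow), (1 - fourier 1 (πM (flow t) p) * ((p.1 : ℕ) : ℂ) ^ (-s))⁻¹ = _
      rw [← Finset.prod_coe_sort (M.primesBelow)]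
      refine Finset.prod_congr rfl fun p _ ↦ ?_
      rw [hcoordM, hg]
    have h2 : Qt (flow t) s = ∏ n ∈ (P.primesBelow).filter (fun n ↦ M ≤ n), g n := by
      rw [hQt, hS, ← prod_univ_filter_coe (P.primesBelow) (fun n ↦ M ≤ n) g]
      show ∏ q ∈ Finset.univ.filter (fun q : ↥(P.primesBelow) ↦ M ≤ q.1),
          (1 - fourier 1 (flow t q) * ((q.1 : ℕ) : ℂ) ^ (-s))⁻¹ = _
      refine Finset.prod_congr rfl fun q _ ↦ ?_
      rw [hcoordS, hg]
    rw [h1, h2]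
    conv_lhs => rw [primesBelow_eq_union hMP, Finset.prod_union (disjoint_primesBelow_filter M P)]
    congr 1
    · exact Finset.prod_congr rfl fun n hn ↦ hg' n (Nat.prime_of_mem_primesBelow hn).ne_zero
    · exact Finset.prod_congr rfl fun n hn ↦
        hg' n (Nat.prime_of_mem_primesBelow (Finset.mem_filter.1 hn).1).ne_zero
  -- Step 5: continuity of the torus functions
  have hZt_contOn : ContinuousOn (fun q : ℂ × UnitAddTorus ↥(P.primesBelow) ↦ Zt q.2 q.1)
      ({s : ℂ | 0 < s.re} ×ˢ univ) := by
    rw [hZt]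
    exact hFc.comp (continuous_fst.prodMk (hπMc.comp continuous_snd)).continuousOn
      fun q hq ↦ ⟨hq.1, mem_univ _⟩
  have hLt_diff : ∀ θ : UnitAddTorus ↥(P.primesBelow), Differentiable ℂ (Lt θ) := by
    intro θ
    rw [hLt]
    refine Differentiable.fun_sum fun q _ ↦ ?_
    have hq0 : ((q.1 : ℕ) : ℂ) ≠ 0 := by
      exact_mod_cast (Nat.prime_of_mem_primesBelow q.2).ne_zero
    exact (differentiable_id.neg.const_cpow (Or.inl hq0)).const_mul _
  have hLtc : Continuous fun q : UnitAddTorus ↥(P.primesBelow) × ℂ ↦ Lt q.1 q.2 := by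
    rw [hLt]
    refine continuous_finsetSum _ fun q _ ↦ ?_
    have hq0 : ((q.1 : ℕ) : ℂ) ≠ 0 := by
      exact_mod_cast (Nat.prime_of_mem_primesBelow q.2).ne_zero
    exact ((fourier 1).continuous.comp ((continuous_apply q).comp continuous_fst)).mul
      (continuous_iff_continuousAt.2 fun x ↦ (continuousAt_const_cpow hq0).comp
        continuous_snd.neg.continuousAt)
  have hφc : Continuous φt := by
    rw [hφt]
    exact continuous_const.max (continuous_const.sub
      ((continuous_const.mul ((hπMc.dist continuous_const))).div_const _))
  -- values of `φ`
  have hφ01 : ∀ θ, 0 ≤ φt θ ∧ φt θ ≤ 1 := by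
    intro θ
    rw [hφt]
    refine ⟨le_max_left _ _, max_le zero_le_one ?_⟩
    have : 0 ≤ 2 * dist (πM θ) θb / r := by positivity
    linarith
  have hφpos : ∀ θ, 0 < φt θ → dist (πM θ) θb < r := by
    intro θ h
    rw [hφt] at h
    rcases lt_max_iff.1 h with h | h
    · exact absurd h (lt_irrefl 0)
    · rw [sub_pos, div_lt_one hr0] at h
      linarith [dist_nonneg (x := πM θ) (y := θb)]
  have hφhalf : ∀ θ, dist (πM θ) θb ≤ r / 4 → 1 / 2 ≤ φt θ := by
    intro θ h
    rw [hφt]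
    refine le_trans ?_ (le_max_right _ _)
    rw [le_sub_comm, div_le_iff₀ hr0]
    linarith
  -- invariance of `φ` under translation of the coordinates `q ≥ M`
  have hπM_inv : ∀ j ∈ S, ∀ (θ : UnitAddTorus ↥(P.primesBelow)) (a : UnitAddCircle),
      πM (θ + Pi.single j a) = πM θ := by
    intro j hj θ a
    have hj' : M ≤ j.1 := by rw [hS] at hj; exact (Finset.mem_filter.1 hj).2
    rw [hπM]
    funext p
    have hne : (⟨p.1, mem_primesBelow_of_le hMP p.2⟩ : ↥(P.primesBelow)) ≠ j := by
      intro h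
      have h2 : p.1 = j.1 := congrArg Subtype.val h
      have := Nat.lt_of_mem_primesBelow p.2
      omega
    simp only [Pi.add_apply, Pi.single_eq_of_ne hne, add_zero]
  have hφinv : ∀ j ∈ S, ∀ (θ : UnitAddTorus ↥(P.primesBelow)) (a : UnitAddCircle),
      φt (θ + Pi.single j a) = φt θ := by
    intro j hj θ a
    rw [hφt]
    simp only [hπM_inv j hj θ a]
  -- the box where `φ ≥ 1/2` and the lower bound `c₁ ≤ ∫ φ`
  obtain ⟨θb', hθb'⟩ : ∃ θb' : ℕ → UnitAddCircle, θb' = fun n ↦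
      if h : n ∈ M.primesBelow then θb ⟨n, h⟩ else 0 := ⟨_, rfl⟩
  have hθb'_eq : ∀ p : ↥(M.primesBelow), θb' p.1 = θb p := fun p ↦ by
    rw [hθb']; simp only [dif_pos p.2]
  have hφbox : ∀ θ : UnitAddTorus ↥(P.primesBelow),
      θ ∈ Set.pi Set.univ (fun q : ↥(P.primesBelow) ↦ if q.1 < M then
        Metric.closedBall (θb' q.1) ((r / 2) / 2) else Set.univ) → 1 / 2 ≤ φt θ := by
    intro θ hθ
    refine hφhalf θ ?_
    rw [Set.mem_pi] at hθ
    refine (dist_pi_le_iff (by positivity)).2 fun p ↦ ?_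
    have h1 := hθ ⟨p.1, mem_primesBelow_of_le hMP p.2⟩ (Set.mem_univ _)
    have hp : p.1 < M := Nat.lt_of_mem_primesBelow p.2
    simp only [hp, if_true, Metric.mem_closedBall] at h1
    rw [hθb'_eq] at h1
    have e : πM θ p = θ ⟨p.1, mem_primesBelow_of_le hMP p.2⟩ := by rw [hπM]
    rw [e]
    linarith
  have hI₁ : c₁ ≤ ∫ θ, φt θ := by
    have hmeas := measurableSet_box (fun q : ↥(P.primesBelow) ↦ q.1 < M) (fun q ↦ θb' q.1) (r / 2)
    have hcard : (Finset.univ.filter fun q : ↥(P.primesBelow) ↦ q.1 < M).card ≤ M := by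
      calc (Finset.univ.filter fun q : ↥(P.primesBelow) ↦ q.1 < M).card
          ≤ (Finset.range M).card := Finset.card_le_card_of_injOn (fun q ↦ q.1)
              (fun q hq ↦ Finset.mem_coe.2 (Finset.mem_range.2 (Finset.mem_filter.1 hq).2))
              (fun q₁ _ q₂ _ h ↦ Subtype.ext h)
        _ = M := Finset.card_range M
    have hvol := pow_le_measureReal_box (fun q : ↥(P.primesBelow) ↦ q.1 < M)
      (fun q ↦ θb' q.1) (by positivity : 0 < r / 2) (by linarith) hcard
    have hind : ∫ θ : UnitAddTorus ↥(P.primesBelow), Set.indicator (Set.pi Set.univ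
        (fun q : ↥(P.primesBelow) ↦ if q.1 < M then
          Metric.closedBall (θb' q.1) ((r / 2) / 2) else Set.univ))
        (fun _ ↦ (1 / 2 : ℝ)) θ ≤ ∫ θ, φt θ := by
      have hfin := isProbabilityMeasure_volume_unitAddTorus (ι := ↥(P.primesBelow))
      refine integral_mono ((integrable_const (1 / 2 : ℝ)).indicator hmeas)
        (integrable_of_continuous hφc) fun θ ↦ ?_
      by_cases hθ : θ ∈ Set.pi Set.univ (fun q : ↥(P.primesBelow) ↦ if q.1 < M then
          Metric.closedBall (θb' q.1) ((r / 2) / 2) else Set.univ)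
      · simp only [Set.indicator_of_mem hθ]; exact hφbox θ hθ
      · simp only [Set.indicator_of_notMem hθ]; exact (hφ01 θ).1
    rw [integral_indicator_const _ hmeas, smul_eq_mul, measureReal_def] at hind
    rw [hc₁]
    linarith
  -- Step 6: the tail: `Λ_L`, `ψ₂ = φ Λ_L`, and `∫ ψ₂ ≤ 2π τ ∫ φ`
  obtain ⟨ΛL, hΛL⟩ : ∃ ΛL : UnitAddTorus ↥(P.primesBelow) → ℝ, ΛL = fun θ ↦
      ∫ u in (0 : ℝ)..2 * Real.pi, ‖Lt θ (circleMap (σ₀ : ℂ) ρ' u)‖ ^ 2 := ⟨_, rfl⟩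
  have hHc : Continuous (Function.uncurry fun (θ : UnitAddTorus ↥(P.primesBelow)) (u : ℝ) ↦
      φt θ * ‖Lt θ (circleMap (σ₀ : ℂ) ρ' u)‖ ^ 2) := by
    have h1 : Continuous fun q : UnitAddTorus ↥(P.primesBelow) × ℝ ↦
        Lt q.1 (circleMap (σ₀ : ℂ) ρ' q.2) :=
      hLtc.comp (continuous_fst.prodMk ((continuous_circleMap _ _).comp continuous_snd))
    exact (hφc.comp continuous_fst).mul ((continuous_norm.comp h1).pow 2)
  have hH'c : Continuous (Function.uncurry fun (θ : UnitAddTorus ↥(P.primesBelow)) (u : ℝ) ↦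
      ‖Lt θ (circleMap (σ₀ : ℂ) ρ' u)‖ ^ 2) := by
    have h1 : Continuous fun q : UnitAddTorus ↥(P.primesBelow) × ℝ ↦
        Lt q.1 (circleMap (σ₀ : ℂ) ρ' q.2) :=
      hLtc.comp (continuous_fst.prodMk ((continuous_circleMap _ _).comp continuous_snd))
    exact (continuous_norm.comp h1).pow 2
  have hΛLc : Continuous ΛL := by
    rw [hΛL]
    exact intervalIntegral.continuous_parametric_intervalIntegral_of_continuous'
      (f := fun θ u ↦ ‖Lt θ (circleMap (σ₀ : ℂ) ρ' u)‖ ^ 2) hH'c _ _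
  have hΛL0 : ∀ θ, 0 ≤ ΛL θ := fun θ ↦ by
    rw [hΛL]; exact intervalIntegral.integral_nonneg (by positivity) fun u _ ↦ by positivity
  have hψc : Continuous fun θ ↦ φt θ * ΛL θ := hφc.mul hΛLc
  -- points of the circle
  have hcirc_mem : ∀ u : ℝ, circleMap (σ₀ : ℂ) ρ' u ∈ closedBall (σ₀ : ℂ) ρ' := fun u ↦
    sphere_subset_closedBall (circleMap_mem_sphere _ hρ'0.le u)
  -- a crude bound for `Lt` (for Fubini) and the sum of squares of its coefficients
  have hLt_bd : ∀ θ (w : ℂ), 0 ≤ w.re → ‖Lt θ w‖ ≤ S.card := by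
    intro θ w hw
    rw [hLt]
    show ‖∑ q ∈ S, fourier 1 (θ q) * ((q.1 : ℕ) : ℂ) ^ (-w)‖ ≤ S.card
    refine (norm_sum_le _ _).trans ?_
    have : ∀ q ∈ S, ‖(fourier 1 (θ q) : ℂ) * ((q.1 : ℕ) : ℂ) ^ (-w)‖ ≤ 1 := by
      intro q _
      have hq1 : 1 ≤ (q.1 : ℝ) := by exact_mod_cast (Nat.prime_of_mem_primesBelow q.2).one_le
      rw [norm_mul, norm_fourier_one, one_mul,
        Complex.norm_natCast_cpow_of_pos (Nat.prime_of_mem_primesBelow q.2).pos, neg_re]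
      exact Real.rpow_le_one_of_one_le_of_nonpos hq1 (by linarith)
    calc ∑ q ∈ S, ‖(fourier 1 (θ q) : ℂ) * ((q.1 : ℕ) : ℂ) ^ (-w)‖ ≤ ∑ q ∈ S, (1 : ℝ) :=
          Finset.sum_le_sum this
      _ = S.card := by simp
  have hcoef : ∀ w : ℂ, σ₁ ≤ w.re →
      ∑ q ∈ S, ‖((q.1 : ℕ) : ℂ) ^ (-w)‖ ^ 2 ≤ τ := by
    intro w hw
    have h1 : ∑ q ∈ S, ‖((q.1 : ℕ) : ℂ) ^ (-w)‖ ^ 2 ≤ ∑ q ∈ S, ((q.1 : ℕ) : ℝ) ^ (-(2 * σ₁)) := by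
      refine Finset.sum_le_sum fun q _ ↦ ?_
      have hq1 : 1 ≤ (q.1 : ℝ) := by exact_mod_cast (Nat.prime_of_mem_primesBelow q.2).one_le
      rw [Complex.norm_natCast_cpow_of_pos (Nat.prime_of_mem_primesBelow q.2).pos, neg_re,
        ← Real.rpow_natCast, ← Real.rpow_mul (by linarith)]
      push_cast
      exact Real.rpow_le_rpow_of_exponent_le hq1 (by linarith)
    have h2 : ∑ q ∈ S, ((q.1 : ℕ) : ℝ) ^ (-(2 * σ₁)) ≤ ∑ n ∈ Finset.Ico M P, (n : ℝ) ^ (-(2 * σ₁)) := by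
      rw [hS, sum_univ_filter_coe (P.primesBelow) (fun n ↦ M ≤ n) (fun n ↦ (n : ℝ) ^ (-(2 * σ₁)))]
      refine Finset.sum_le_sum_of_subset_of_nonneg (fun n hn ↦ ?_) fun n _ _ ↦ by positivity
      rw [Finset.mem_filter, Nat.mem_primesBelow] at hn
      exact Finset.mem_Ico.2 ⟨hn.2, hn.1.1⟩
    have h3 := sum_Ico_rpow_le_tsum hσ₁h M P
    rw [← hτ] at h3
    linarith
  -- the orthogonality on each point of the circle, and `∫ ψ₂ ≤ 2π τ I₁`
  have horth : ∀ w : ℂ, ∫ θ, φt θ * ‖Lt θ w‖ ^ 2 =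
      (∑ q ∈ S, ‖((q.1 : ℕ) : ℂ) ^ (-w)‖ ^ 2) * ∫ θ, φt θ := by
    intro w
    have e : ∀ θ : UnitAddTorus ↥(P.primesBelow), Lt θ w =
        ∑ q ∈ S, ((q.1 : ℕ) : ℂ) ^ (-w) * fourier 1 (θ q) := by
      intro θ; rw [hLt]; exact Finset.sum_congr rfl fun q _ ↦ mul_comm _ _
    simp_rw [e]
    exact integral_mul_norm_sq_sum_fourier_complex S (fun q ↦ ((q.1 : ℕ) : ℂ) ^ (-w)) hφc hφinv
  have hI₁0 : 0 ≤ ∫ θ, φt θ := integral_nonneg fun θ ↦ (hφ01 θ).1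
  have hI₂ : ∫ θ, φt θ * ΛL θ ≤ 2 * Real.pi * τ * ∫ θ, φt θ := by
    have e1 : ∫ θ, φt θ * ΛL θ = ∫ θ, ∫ u in (0 : ℝ)..2 * Real.pi,
        φt θ * ‖Lt θ (circleMap (σ₀ : ℂ) ρ' u)‖ ^ 2 := by
      refine integral_congr_ae (ae_of_all _ fun θ ↦ ?_)
      rw [hΛL]
      exact (intervalIntegral.integral_const_mul _ _).symm
    have e2 := integral_torus_interval_swap (C := (S.card : ℝ) ^ 2) hHc (fun θ u ↦ by
      rw [Real.norm_of_nonneg (mul_nonneg (hφ01 θ).1 (by positivity))]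
      have h1 := hLt_bd θ (circleMap (σ₀ : ℂ) ρ' u) (by linarith [(hre_ball _ (hcirc_mem u)).1])
      have h2 := (hφ01 θ).2
      have h3 := (hφ01 θ).1
      calc φt θ * ‖Lt θ (circleMap (σ₀ : ℂ) ρ' u)‖ ^ 2 ≤ 1 * (S.card : ℝ) ^ 2 := by
            refine mul_le_mul h2 ?_ (by positivity) zero_le_one
            exact pow_le_pow_left₀ (norm_nonneg _) h1 2
        _ = (S.card : ℝ) ^ 2 := one_mul _) (by positivity : (0 : ℝ) ≤ 2 * Real.pi)
    rw [e1, e2]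
    have hbound : ∀ u ∈ Set.uIoc (0 : ℝ) (2 * Real.pi),
        ‖∫ θ, φt θ * ‖Lt θ (circleMap (σ₀ : ℂ) ρ' u)‖ ^ 2‖ ≤ τ * ∫ θ, φt θ := by
      intro u _
      rw [horth, Real.norm_of_nonneg (mul_nonneg (Finset.sum_nonneg fun q _ ↦ by positivity) hI₁0)]
      exact mul_le_mul_of_nonneg_right (hcoef _ (hre_ball _ (hcirc_mem u)).1) hI₁0
    have h := intervalIntegral.norm_integral_le_of_norm_le_const hbound
    rw [sub_zero, abs_of_pos (by positivity)] at h
    have h' := le_abs_self (∫ u in (0 : ℝ)..2 * Real.pi,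
      ∫ θ, φt θ * ‖Lt θ (circleMap (σ₀ : ℂ) ρ' u)‖ ^ 2)
    rw [← Real.norm_eq_abs] at h'
    exact h'.trans (h.trans (le_of_eq (by ring)))
  -- Step 7: Kronecker–Weyl for `φ` and `ψ₂ = φ Λ_L`
  set Φc : C(UnitAddTorus ↥(P.primesBelow), ℝ) := ⟨φt, hφc⟩ with hΦc
  set Ψc : C(UnitAddTorus ↥(P.primesBelow), ℝ) := ⟨fun θ ↦ φt θ * ΛL θ, hψc⟩ with hΨc
  have hA₁ := tendsto_avg_integral_comp_flow_real hlin Φc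
  have hA₂ := tendsto_avg_integral_comp_flow_real hlin Ψc
  have hΦcoe : ∀ θ, Φc θ = φt θ := fun θ ↦ rfl
  have hΨcoe : ∀ θ, Ψc θ = φt θ * ΛL θ := fun θ ↦ rfl
  have hflow_apply : ∀ t : ℝ, (fun i ↦ ((t * l i : ℝ) : UnitAddCircle)) = flow t := by
    intro t; rw [hflow]
  -- Step 8: the error `ζ - ∏_{p<P}` on the circle: `Λ₃`, and `J₃ ≤ 2π ε' T`
  obtain ⟨E, hE⟩ : ∃ E : ℝ → ℂ → ℂ, E = fun (t : ℝ) (w : ℂ) ↦ riemannZeta (w + t * I) -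
      ∏ p ∈ P.primesBelow, (1 - (p : ℂ) ^ (-(w + t * I)))⁻¹ := ⟨_, rfl⟩
  have hstrip : ∀ (t u : ℝ), circleMap (σ₀ : ℂ) ρ' u + t * I ∈ {z : ℂ | 0 < z.re ∧ z.re < 1} := by
    intro t u
    have h := hre_ball _ (hcirc_mem u)
    simp only [Set.mem_setOf_eq, add_re, mul_re, ofReal_re, I_re, mul_zero, ofReal_im, I_im,
      mul_one, sub_self, add_zero]
    exact ⟨by linarith [h.1], by linarith [h.2]⟩
  have hH₃c : Continuous (Function.uncurry fun (t u : ℝ) ↦ ‖E t (circleMap (σ₀ : ℂ) ρ' u)‖ ^ 2) := by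
    have hmap : Continuous fun q : ℝ × ℝ ↦ circleMap (σ₀ : ℂ) ρ' q.2 + q.1 * I := by fun_prop
    have h := (EulerProductMeanSquareUniform.continuousOn_zeta_sub_eulerProduct P).comp_continuous
      hmap fun q ↦ hstrip q.1 q.2
    have e : (Function.uncurry fun (t u : ℝ) ↦ ‖E t (circleMap (σ₀ : ℂ) ρ' u)‖ ^ 2) =
        fun q : ℝ × ℝ ↦ ‖(fun z : ℂ ↦ riemannZeta z - ∏ p ∈ P.primesBelow, (1 - (p : ℂ) ^ (-z))⁻¹)
          (circleMap (σ₀ : ℂ) ρ' q.2 + q.1 * I)‖ ^ 2 := by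
      funext q; rw [hE]; rfl
    rw [e]
    exact (continuous_norm.comp h).pow 2
  obtain ⟨Λ₃, hΛ₃⟩ : ∃ Λ₃ : ℝ → ℝ, Λ₃ = fun t ↦
      ∫ u in (0 : ℝ)..2 * Real.pi, ‖E t (circleMap (σ₀ : ℂ) ρ' u)‖ ^ 2 := ⟨_, rfl⟩
  have hΛ₃c : Continuous Λ₃ := by
    rw [hΛ₃]
    exact intervalIntegral.continuous_parametric_intervalIntegral_of_continuous'
      (f := fun t u ↦ ‖E t (circleMap (σ₀ : ℂ) ρ' u)‖ ^ 2) hH₃c _ _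
  have hΛ₃0 : ∀ t, 0 ≤ Λ₃ t := fun t ↦ by
    rw [hΛ₃]; exact intervalIntegral.integral_nonneg (by positivity) fun u _ ↦ by positivity
  have hJ₃ : ∀ T : ℝ, T₀ ≤ T → 0 ≤ T → ∫ t in (0 : ℝ)..T, Λ₃ t ≤ 2 * Real.pi * ε' * T := by
    intro T hT hT0'
    have e1 : ∫ t in (0 : ℝ)..T, Λ₃ t =
        ∫ t in (0 : ℝ)..T, ∫ u in (0 : ℝ)..2 * Real.pi, ‖E t (circleMap (σ₀ : ℂ) ρ' u)‖ ^ 2 := by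
      rw [hΛ₃]
    rw [e1, integral_interval_interval_swap hH₃c hT0' (by positivity)]
    have hinner : ∀ u ∈ Set.uIoc (0 : ℝ) (2 * Real.pi),
        ‖∫ t in (0 : ℝ)..T, ‖E t (circleMap (σ₀ : ℂ) ρ' u)‖ ^ 2‖ ≤ ε' * T := by
      intro u _
      rw [Real.norm_of_nonneg (intervalIntegral.integral_nonneg hT0' fun t _ ↦ by positivity)]
      obtain ⟨h1, h2, h3⟩ := circle_coords_mem (σ₀ := σ₀) hρ'0.le u
      have key := hT₀ T hT (σ₀ + ρ' * Real.cos u) (by rw [hσ₁]; linarith) h2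
        (ρ' * Real.sin u) h3
      refine le_of_eq_of_le ?_ key
      refine intervalIntegral.integral_congr fun t _ ↦ ?_
      have e : circleMap (σ₀ : ℂ) ρ' u + t * I =
          ((σ₀ + ρ' * Real.cos u : ℝ) : ℂ) + ((t : ℂ) + ((ρ' * Real.sin u : ℝ) : ℂ)) * I := by
        rw [circleMap_add_mul_I]; push_cast; ring
      simp only [hE, e]
    have h := intervalIntegral.norm_integral_le_of_norm_le_const hinner
    rw [sub_zero, abs_of_pos (by positivity)] at h
    have h' := le_abs_self (∫ u in (0 : ℝ)..2 * Real.pi,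
      ∫ t in (0 : ℝ)..T, ‖E t (circleMap (σ₀ : ℂ) ρ' u)‖ ^ 2)
    rw [← Real.norm_eq_abs] at h'
    exact h'.trans (h.trans (le_of_eq (by ring)))
  -- Step 9: the time integrals, the test function and a good `t ≥ T₁`
  obtain ⟨Φ, hΦ⟩ : ∃ Φ : ℝ → ℝ, Φ = fun t ↦ φt (flow t) := ⟨_, rfl⟩
  obtain ⟨Λ, hΛ⟩ : ∃ Λ : ℝ → ℝ, Λ = fun t ↦ ΛL (flow t) := ⟨_, rfl⟩
  have hΦcont : Continuous Φ := by rw [hΦ]; exact hφc.comp hflowc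
  have hΛcont : Continuous Λ := by rw [hΛ]; exact hΛLc.comp hflowc
  have hΦ01 : ∀ t, 0 ≤ Φ t ∧ Φ t ≤ 1 := fun t ↦ by rw [hΦ]; exact hφ01 _
  have hΛ0' : ∀ t, 0 ≤ Λ t := fun t ↦ by rw [hΛ]; exact hΛL0 _
  obtain ⟨g, hg⟩ : ∃ g : ℝ → ℝ, g = fun t ↦ Φ t * (1 - Λ t / δ₂ - Λ₃ t / δ₃) := ⟨_, rfl⟩
  have hgc : Continuous g := by
    rw [hg]; exact hΦcont.mul ((continuous_const.sub (hΛcont.div_const _)).sub (hΛ₃c.div_const _))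
  have hg1 : ∀ t, g t ≤ 1 := by
    intro t
    rw [hg]
    have hX : 0 ≤ Λ t / δ₂ := div_nonneg (hΛ0' t) hδ₂0.le
    have hY : 0 ≤ Λ₃ t / δ₃ := div_nonneg (hΛ₃0 t) hδ₃0.le
    calc Φ t * (1 - Λ t / δ₂ - Λ₃ t / δ₃) ≤ Φ t := mul_le_of_le_one_right (hΦ01 t).1 (by linarith)
      _ ≤ 1 := (hΦ01 t).2
  -- choose `T`
  obtain ⟨T₁', hT₁'⟩ : ∃ T₁' : ℝ, T₁' = max T₁ 0 := ⟨_, rfl⟩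
  have hT₁'0 : 0 ≤ T₁' := by rw [hT₁']; exact le_max_right _ _
  have hI₂' : ∫ θ, φt θ * ΛL θ < 2 * Real.pi * τ * (∫ θ, φt θ) + δ₂ * c₁ / 16 := by
    have : 0 < δ₂ * c₁ / 16 := by positivity
    linarith
  have e1 : ∀ᶠ T : ℝ in atTop, (∫ θ, φt θ) - c₁ / 16 <
      T⁻¹ * ∫ t in (0 : ℝ)..T, Φc (fun i ↦ ((t * l i : ℝ) : UnitAddCircle)) :=
    hA₁.eventually_const_lt (by show (∫ θ, φt θ) - c₁ / 16 < ∫ θ, Φc θ; simp only [hΦcoe]; linarith)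
  have e2 : ∀ᶠ T : ℝ in atTop, T⁻¹ * ∫ t in (0 : ℝ)..T, Ψc (fun i ↦ ((t * l i : ℝ) : UnitAddCircle)) <
      2 * Real.pi * τ * (∫ θ, φt θ) + δ₂ * c₁ / 16 :=
    hA₂.eventually_lt_const (by simp only [hΨcoe]; exact hI₂')
  have e4 : ∀ᶠ T : ℝ in atTop, max (max T₀ 1) T₁' ≤ T := eventually_ge_atTop _
  have e5 : ∀ᶠ T : ℝ in atTop, T₁' + 1 ≤ c₁ / 4 * T :=
    (Tendsto.const_mul_atTop (by positivity) tendsto_id).eventually_ge_atTop _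
  obtain ⟨T, h1, h2, h4, h5⟩ := (e1.and (e2.and (e4.and e5))).exists
  have hTT₀ : T₀ ≤ T := ((le_max_left _ _).trans (le_max_left _ _)).trans h4
  have hT1 : 1 ≤ T := ((le_max_right _ _).trans (le_max_left _ _)).trans h4
  have hT₁'T : T₁' ≤ T := (le_max_right _ _).trans h4
  have hT0 : 0 < T := by linarith
  clear e1 e2 e4 e5 hA₁ hA₂
  -- the three time integrals
  have hJ₁ : ∫ t in (0 : ℝ)..T, Φ t = T * (T⁻¹ * ∫ t in (0 : ℝ)..T, Φc (fun i ↦ ((t * l i : ℝ) : UnitAddCircle))) := by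
    rw [← mul_assoc, mul_inv_cancel₀ hT0.ne', one_mul, hΦ]
    refine intervalIntegral.integral_congr fun t _ ↦ ?_
    rw [hΦcoe, hflow_apply]
  have hJ₂ : ∫ t in (0 : ℝ)..T, Φ t * Λ t =
      T * (T⁻¹ * ∫ t in (0 : ℝ)..T, Ψc (fun i ↦ ((t * l i : ℝ) : UnitAddCircle))) := by
    rw [← mul_assoc, mul_inv_cancel₀ hT0.ne', one_mul, hΦ, hΛ]
    refine intervalIntegral.integral_congr fun t _ ↦ ?_
    rw [hΨcoe, hflow_apply]
  have hJ₃' : ∫ t in (0 : ℝ)..T, Φ t * Λ₃ t ≤ δ₃ * c₁ / 4 * T := by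
    have h := hJ₃ T hTT₀ hT0.le
    have hle : ∫ t in (0 : ℝ)..T, Φ t * Λ₃ t ≤ ∫ t in (0 : ℝ)..T, Λ₃ t :=
      intervalIntegral.integral_mono_on hT0.le ((hΦcont.mul hΛ₃c).intervalIntegrable _ _)
        (hΛ₃c.intervalIntegrable _ _) fun t _ ↦ mul_le_of_le_one_left (hΛ₃0 t) (hΦ01 t).2
    have e : 2 * Real.pi * ε' = δ₃ * c₁ / 4 := by rw [hε']; field_simp; ring
    rw [← e]
    linarith
  -- bookkeeping: `∫₀ᵀ g ≥ (c₁/4) T`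
  have hbook := integral_bookkeeping (s := 2 * Real.pi * τ) (d := δ₂) (e := δ₃) hT0 hc₁0 hI₁ hδ₂0
    (by
      rw [hδ₂]
      have : 2 * Real.pi * τ < 2 * Real.pi * (δ₁ ^ 2 / (8 * Real.pi)) := by
        exact mul_lt_mul_of_pos_left hτδ₂ (by positivity)
      have e : 2 * Real.pi * (δ₁ ^ 2 / (8 * Real.pi)) = δ₁ ^ 2 / 4 := by field_simp; ring
      linarith) hδ₃0 h1 h2 hJ₁ (le_of_eq hJ₂) hJ₃'
  have hg_int : ∫ t in (0 : ℝ)..T, g t =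
      (∫ t in (0 : ℝ)..T, Φ t) - (∫ t in (0 : ℝ)..T, Φ t * Λ t) / δ₂ -
        (∫ t in (0 : ℝ)..T, Φ t * Λ₃ t) / δ₃ := by
    have hi1 : IntervalIntegrable Φ volume 0 T := hΦcont.intervalIntegrable _ _
    have hi2 : IntervalIntegrable (fun t ↦ Φ t * Λ t / δ₂) volume 0 T :=
      ((hΦcont.mul hΛcont).div_const _).intervalIntegrable _ _
    have hi3 : IntervalIntegrable (fun t ↦ Φ t * Λ₃ t / δ₃) volume 0 T :=
      ((hΦcont.mul hΛ₃c).div_const _).intervalIntegrable _ _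
    have e : g = fun t ↦ Φ t - Φ t * Λ t / δ₂ - Φ t * Λ₃ t / δ₃ := by
      rw [hg]; funext t; ring
    rw [e, intervalIntegral.integral_sub (hi1.sub hi2) hi3, intervalIntegral.integral_sub hi1 hi2,
      intervalIntegral.integral_div, intervalIntegral.integral_div]
  have hbig : c₁ / 4 * T ≤ ∫ t in (0 : ℝ)..T, g t := by rw [hg_int]; exact hbook
  -- split at `T₁'`: `∫₀^{T₁'} g ≤ T₁'`
  have hhead : ∫ t in (0 : ℝ)..T₁', g t ≤ T₁' := by
    have h : ∫ t in (0 : ℝ)..T₁', g t ≤ ∫ _ in (0 : ℝ)..T₁', (1 : ℝ) :=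
      intervalIntegral.integral_mono_on hT₁'0 (hgc.intervalIntegrable _ _) intervalIntegrable_const
        fun t _ ↦ hg1 t
    simpa using h
  have hsplit := intervalIntegral.integral_add_adjacent_intervals (hgc.intervalIntegrable (μ := volume) 0 T₁')
    (hgc.intervalIntegrable (μ := volume) T₁' T)
  have hpos : 0 < ∫ t in T₁'..T, g t := by linarith
  -- a good `t ∈ [T₁', T]`
  obtain ⟨t, ht, hgt⟩ : ∃ t ∈ Icc T₁' T, 0 < g t := by
    by_contra hcon
    push Not at hcon
    have : ∫ t in T₁'..T, g t ≤ 0 := by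
      rw [intervalIntegral.integral_of_le hT₁'T]
      exact setIntegral_nonpos measurableSet_Ioc fun t ht ↦ hcon t ⟨ht.1.le, ht.2⟩
    linarith
  refine ⟨t, (le_max_left T₁ 0).trans (hT₁' ▸ ht.1), ?_⟩
  -- unpack `g t > 0`
  have hΦt : 0 < Φ t ∧ 0 < 1 - Λ t / δ₂ - Λ₃ t / δ₃ := by
    rw [hg] at hgt
    rcases pos_and_pos_or_neg_and_neg_of_mul_pos hgt with h | h
    · exact h
    · exact absurd h.1 (not_lt.2 (hΦ01 t).1)
  have hΛt : Λ t < δ₂ := by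
    have h0 : 0 ≤ Λ₃ t / δ₃ := div_nonneg (hΛ₃0 t) hδ₃0.le
    have : Λ t / δ₂ < 1 := by linarith [hΦt.2]
    rwa [div_lt_one hδ₂0] at this
  have hΛ₃t : Λ₃ t < δ₃ := by
    have h0 : 0 ≤ Λ t / δ₂ := div_nonneg (hΛ0' t) hδ₂0.le
    have : Λ₃ t / δ₃ < 1 := by linarith [hΦt.2]
    rwa [div_lt_one hδ₃0] at this
  -- Step 10: the conclusion at the good shift `t`, for `s` in the disc
  intro s hs
  obtain ⟨hsre, hsre1⟩ := hre_small s hs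
  have hs' : s ∈ closedBall (σ₀ : ℂ) ρ' := closedBall_subset_closedBall hρρ'.le hs
  obtain ⟨θt, hθt⟩ : ∃ θt : UnitAddTorus ↥(P.primesBelow), θt = flow t := ⟨_, rfl⟩
  -- (i) the head phases are in the box: `Zt θt` is `κ₁`-close to the target product
  have hΦt' : 0 < φt θt := by rw [hθt]; have := hΦt.1; rwa [hΦ] at this
  have hhead : ‖Zt θt s - ∏ p ∈ M.primesBelow, (1 - b p * (p : ℂ) ^ (-s))⁻¹‖ < κ₁ := by
    rw [← hFb s, hZt]
    exact hrad (πM θt) (hφpos θt hΦt') s hs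
  have hZtn : ‖Zt θt s‖ ≤ K' := by
    have h1 := norm_le_norm_add_norm_sub' (Zt θt s) (∏ p ∈ M.primesBelow, (1 - b p * (p : ℂ) ^ (-s))⁻¹)
    have h2 := hbound s hs
    rw [hK']; linarith [hhead.le]
  -- (ii) the tail sum is small on the disc, hence the tail product is close to `1`
  have hLs : ‖Lt θt s‖ < δ₁ := by
    have hd : DiffContOnCl ℂ (Lt θt) (ball (σ₀ : ℂ) ρ') := (hLt_diff θt).diffContOnCl
    have h := norm_sq_le_mul_integral_norm_sq_circle hρ.le hρρ' hd hs
    have hΛ' : ∫ u in (0 : ℝ)..2 * Real.pi, ‖Lt θt (circleMap (σ₀ : ℂ) ρ' u)‖ ^ 2 = Λ t := by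
      rw [hΛ, hΛL, hθt]
    rw [hΛ'] at h
    have h2 : ‖Lt θt s‖ ^ 2 < δ₁ ^ 2 := by
      calc ‖Lt θt s‖ ^ 2 ≤ ρ' ^ 2 / (2 * Real.pi * (ρ' - ρ) ^ 2) * Λ t := h
        _ ≤ 1 * Λ t := mul_le_mul_of_nonneg_right hCcirc (hΛ0' t)
        _ < δ₁ ^ 2 := by rw [one_mul, ← hδ₂]; exact hΛt
    exact lt_of_pow_lt_pow_left₀ 2 hδ₁0.le h2
  have hQ1 : ‖Qt θt s - 1‖ ≤ 4 * δ₁ := by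
    have hz : ∀ q ∈ S, ‖(fourier 1 (θt q) : ℂ) * ((q.1 : ℕ) : ℂ) ^ (-s)‖ ≤ 1 / 2 := by
      intro q hq
      have hqM : M ≤ q.1 := by rw [hS] at hq; exact (Finset.mem_filter.1 hq).2
      have h4q : (4 : ℝ) ≤ q.1 := by exact_mod_cast hM4.trans hqM
      rw [norm_mul, norm_fourier_one, one_mul,
        Complex.norm_natCast_cpow_of_pos (Nat.prime_of_mem_primesBelow q.2).pos, neg_re]
      calc ((q.1 : ℕ) : ℝ) ^ (-s.re) ≤ (4 : ℝ) ^ (-s.re) :=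
            Real.rpow_le_rpow_of_nonpos (by norm_num) h4q (by linarith)
        _ ≤ (4 : ℝ) ^ (-(1 / 2) : ℝ) := Real.rpow_le_rpow_of_exponent_le (by norm_num) (by linarith)
        _ = 1 / 2 := by
            rw [show (4 : ℝ) = 2 ^ (2 : ℝ) by norm_num, ← Real.rpow_mul (by norm_num)]
            norm_num
    have hsq : ∑ q ∈ S, ‖(fourier 1 (θt q) : ℂ) * ((q.1 : ℕ) : ℂ) ^ (-s)‖ ^ 2 ≤ τ := by
      have e : ∀ q ∈ S, ‖(fourier 1 (θt q) : ℂ) * ((q.1 : ℕ) : ℂ) ^ (-s)‖ ^ 2 =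
          ‖((q.1 : ℕ) : ℂ) ^ (-s)‖ ^ 2 := fun q _ ↦ by rw [norm_mul, norm_fourier_one, one_mul]
      rw [Finset.sum_congr rfl e]
      exact hcoef s hsre
    have hsum : ‖∑ q ∈ S, (fourier 1 (θt q) : ℂ) * ((q.1 : ℕ) : ℂ) ^ (-s)‖ < δ₁ := by
      have : Lt θt s = ∑ q ∈ S, (fourier 1 (θt q) : ℂ) * ((q.1 : ℕ) : ℂ) ^ (-s) := by rw [hLt]
      rw [← this]; exact hLs
    have h := norm_prod_inv_one_sub_sub_one_le S hz (by linarith)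
    have e : Qt θt s = ∏ q ∈ S, (1 - (fourier 1 (θt q) : ℂ) * ((q.1 : ℕ) : ℂ) ^ (-s))⁻¹ := by rw [hQt]
    rw [e]
    linarith
  -- (iii) the error `ζ(· + it) - ∏_{p<P}` is small on the disc
  have hEs : ‖E t s‖ < κ / 4 := by
    have hU : closedBall (σ₀ : ℂ) ρ' ⊆ {w : ℂ | 0 < w.re ∧ w.re < 1} := fun w hw ↦ by
      have h := hre_ball w hw
      exact ⟨by linarith [h.1], by linarith [h.2]⟩
    have hEd : DifferentiableOn ℂ (E t) {w : ℂ | 0 < w.re ∧ w.re < 1} := by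
      intro w hw
      rw [hE]
      have hw1 : w + t * I ≠ 1 := fun h ↦ by
        have := congrArg Complex.re h
        simp at this
        linarith [hw.2]
      refine (DifferentiableAt.sub ?_ ?_).differentiableWithinAt
      · exact (differentiableAt_riemannZeta hw1).comp w (differentiableAt_id.add_const _)
      · refine DifferentiableAt.fun_finsetProd fun p hp ↦ ?_
        have hp2 := (Nat.prime_of_mem_primesBelow hp).two_le
        have hp0 : (p : ℂ) ≠ 0 := by exact_mod_cast (Nat.prime_of_mem_primesBelow hp).ne_zero
        refine ((differentiableAt_const _).sub ?_).inv ?_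
        · exact ((differentiableAt_id.add_const _).neg).const_cpow (Or.inl hp0)
        · have hre : 0 < (w + t * I).re := by simp; exact hw.1
          have := one_sub_prime_cpow_ne_zero (Nat.prime_of_mem_primesBelow hp) hre
          exact this
    have hd : DiffContOnCl ℂ (E t) (ball (σ₀ : ℂ) ρ') := hEd.diffContOnCl_ball hU
    have h := norm_sq_le_mul_integral_norm_sq_circle hρ.le hρρ' hd hs
    have hΛ' : ∫ u in (0 : ℝ)..2 * Real.pi, ‖E t (circleMap (σ₀ : ℂ) ρ' u)‖ ^ 2 = Λ₃ t := by
      rw [hΛ₃]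
    rw [hΛ'] at h
    have h2 : ‖E t s‖ ^ 2 < (κ / 4) ^ 2 := by
      calc ‖E t s‖ ^ 2 ≤ ρ' ^ 2 / (2 * Real.pi * (ρ' - ρ) ^ 2) * Λ₃ t := h
        _ ≤ 1 * Λ₃ t := mul_le_mul_of_nonneg_right hCcirc (hΛ₃0 t)
        _ < (κ / 4) ^ 2 := by rw [one_mul, ← hδ₃]; exact hΛ₃t
    exact lt_of_pow_lt_pow_left₀ 2 (by positivity) h2
  -- (iv) combine
  have hdecomp : riemannZeta (s + t * I) - ∏ p ∈ M.primesBelow, (1 - b p * (p : ℂ) ^ (-s))⁻¹ =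
      E t s + Zt θt s * (Qt θt s - 1) +
        (Zt θt s - ∏ p ∈ M.primesBelow, (1 - b p * (p : ℂ) ^ (-s))⁻¹) := by
    have e : E t s = riemannZeta (s + t * I) - Zt θt s * Qt θt s := by
      rw [hE, hθt, ← hEuler t s]
    rw [e]; ring
  rw [hdecomp]
  have hmid : ‖Zt θt s * (Qt θt s - 1)‖ ≤ κ / 4 := by
    rw [norm_mul]
    calc ‖Zt θt s‖ * ‖Qt θt s - 1‖ ≤ K' * (4 * δ₁) :=
          mul_le_mul hZtn hQ1 (norm_nonneg _) hK'0.le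
      _ ≤ κ / 4 := hδ₁K
  calc ‖E t s + Zt θt s * (Qt θt s - 1) +
        (Zt θt s - ∏ p ∈ M.primesBelow, (1 - b p * (p : ℂ) ^ (-s))⁻¹)‖
      ≤ ‖E t s‖ + ‖Zt θt s * (Qt θt s - 1)‖ +
        ‖Zt θt s - ∏ p ∈ M.primesBelow, (1 - b p * (p : ℂ) ^ (-s))⁻¹‖ := norm_add₃_le
    _ ≤ κ / 4 + κ / 4 + κ / 4 := by
        have := hhead.le; rw [hκ₁] at this
        linarith [hEs.le, hmid]
    _ ≤ κ := by linarith


/-! ## `a`-points beyond every height, and the barrier unconditionally -/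

open Literature.NumberTheory.LFunctions in
/-- **Every `a ≠ 0` is taken by `ζ` in every strip `1/2 < α < Re s < β < 1` beyond every height**
(Titchmarsh, Thm. 11.10 and its corollary, qualitative form: "`N_{a,α,β}(T) > K(a,α,β) T`" in
particular tends to infinity). Proof: robust target `G` with `G(σ₀) = a`, `σ₀ = (α+β)/2`
(`exists_robustTarget`); a circle `|s - σ₀| = ρ` on which `|G - a| ≥ m > 0`; a truncated Euler
product within `m/4` of `G` on the disc; a shift `t` beyond the prescribed height with `ζ(· + it)`
within `m/4` of it (`exists_shift_near_eulerProduct_on_disc`); Rouché.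
[cite: Titchmarsh1986, §11.10 (Thm. 11.10 and corollary)] -/
theorem exists_aPoint_gt {a : ℂ} (ha : a ≠ 0) {α β : ℝ} (hα : 1 / 2 < α) (hαβ : α < β)
    (hβ : β < 1) (T₀ : ℝ) : ∃ s : ℂ, α < s.re ∧ s.re < β ∧ T₀ < s.im ∧ riemannZeta s = a := by
  -- centre and robust target
  obtain ⟨σ₀, hσ₀⟩ : ∃ σ₀ : ℝ, σ₀ = (α + β) / 2 := ⟨_, rfl⟩
  have hσ₀h : 1 / 2 < σ₀ := by rw [hσ₀]; linarith
  have hσ₀1 : σ₀ < 1 := by rw [hσ₀]; linarith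
  obtain ⟨G, hGd, hGσ₀, hGne, hGapprox⟩ := exists_robustTarget ha hσ₀h hσ₀1
  -- a punctured ball on which `G ≠ a`
  obtain ⟨ρ₁, hρ₁0, hρ₁⟩ : ∃ ρ₁ > 0, ∀ s : ℂ, dist s σ₀ < ρ₁ → s ≠ σ₀ → G s ≠ a := by
    rw [eventually_nhdsWithin_iff, Metric.eventually_nhds_iff] at hGne
    obtain ⟨ρ₁, h0, h⟩ := hGne
    exact ⟨ρ₁, h0, fun s hs hne ↦ h hs hne⟩
  -- the radius `ρ`
  obtain ⟨ρ, hρ0, hρ1, hρ2, hρ3, hρ4⟩ : ∃ ρ : ℝ, 0 < ρ ∧ ρ ≤ (β - α) / 2 ∧ 1 / 2 < σ₀ - 2 * ρ ∧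
      σ₀ + 2 * ρ < 1 ∧ ρ < ρ₁ := by
    refine ⟨min (min ((β - α) / 2) ((σ₀ - 1 / 2) / 4)) (min ((1 - σ₀) / 4) (ρ₁ / 2)),
      ?_, ?_, ?_, ?_, ?_⟩
    · exact lt_min (lt_min (by linarith) (by linarith)) (lt_min (by linarith) (by linarith))
    · exact (min_le_left _ _).trans (min_le_left _ _)
    · have : min (min ((β - α) / 2) ((σ₀ - 1 / 2) / 4)) (min ((1 - σ₀) / 4) (ρ₁ / 2)) ≤
          (σ₀ - 1 / 2) / 4 := (min_le_left _ _).trans (min_le_right _ _)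
      linarith
    · have : min (min ((β - α) / 2) ((σ₀ - 1 / 2) / 4)) (min ((1 - σ₀) / 4) (ρ₁ / 2)) ≤
          (1 - σ₀) / 4 := (min_le_right _ _).trans (min_le_left _ _)
      linarith
    · have : min (min ((β - α) / 2) ((σ₀ - 1 / 2) / 4)) (min ((1 - σ₀) / 4) (ρ₁ / 2)) ≤ ρ₁ / 2 :=
        (min_le_right _ _).trans (min_le_right _ _)
      linarith
  have hρσ : ρ < σ₀ - 1 / 2 := by linarith
  -- the closed disc lies in `Re s > 1/2`
  have hballU : closedBall (σ₀ : ℂ) ρ ⊆ {s : ℂ | 1 / 2 < s.re} := by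
    intro s hs
    rw [mem_closedBall, dist_eq_norm] at hs
    have h := (abs_re_le_norm (s - σ₀)).trans hs
    rw [sub_re, ofReal_re, abs_le] at h
    show 1 / 2 < s.re
    linarith [h.1]
  have hGc : ContinuousOn G (closedBall (σ₀ : ℂ) ρ) := hGd.continuousOn.mono hballU
  -- `m = min_{|w - σ₀| = ρ} |G(w) - a| > 0`
  have hcont : ContinuousOn (fun w ↦ ‖G w - a‖) (sphere (σ₀ : ℂ) ρ) :=
    ((hGc.mono sphere_subset_closedBall).sub continuousOn_const).norm
  obtain ⟨w₀, hw₀, hmin⟩ := (isCompact_sphere (σ₀ : ℂ) ρ).exists_isMinOn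
    (NormedSpace.sphere_nonempty.2 hρ0.le) hcont
  obtain ⟨m, hm⟩ : ∃ m : ℝ, m = ‖G w₀ - a‖ := ⟨_, rfl⟩
  have hm0 : 0 < m := by
    rw [hm, norm_pos_iff, sub_ne_zero]
    have hd : dist w₀ (σ₀ : ℂ) = ρ := mem_sphere.1 hw₀
    refine hρ₁ w₀ (by rw [hd]; exact hρ4) fun h ↦ ?_
    rw [h, dist_self] at hd
    exact hρ0.ne hd
  have hmle : ∀ w ∈ sphere (σ₀ : ℂ) ρ, m ≤ ‖G w - a‖ := fun w hw ↦ by rw [hm]; exact hmin hw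
  -- a bound for `G` on the disc
  obtain ⟨K₀, hK₀⟩ := (isCompact_closedBall (σ₀ : ℂ) ρ).exists_bound_of_continuousOn hGc
  obtain ⟨K, hK⟩ : ∃ K : ℝ, K = max K₀ 0 + 1 := ⟨_, rfl⟩
  have hK0 : 0 ≤ K := by rw [hK]; positivity
  -- Step A: the threshold `M₁`
  obtain ⟨M₁, hM₁⟩ := exists_shift_near_eulerProduct_on_disc hρ0 hρ2 hρ3
    (show 0 < m / 4 by positivity) hK0
  -- the truncation of the robust target
  obtain ⟨M', hM', b, hb, happ⟩ := hGapprox (min (m / 4) 1) (lt_min (by positivity) one_pos)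
    M₁ ρ hρ0 hρσ
  have happ' : ∀ s ∈ closedBall (σ₀ : ℂ) ρ,
      ‖∏ p ∈ M'.primesBelow, (1 - b p * (p : ℂ) ^ (-s))⁻¹ - G s‖ < min (m / 4) 1 := fun s hs ↦
    happ s hs
  have hbound : ∀ s ∈ closedBall (σ₀ : ℂ) ρ,
      ‖∏ p ∈ M'.primesBelow, (1 - b p * (p : ℂ) ^ (-s))⁻¹‖ ≤ K := by
    intro s hs
    have h1 := happ' s hs
    have h2 := hK₀ s hs
    have h3 := norm_le_norm_add_norm_sub' (∏ p ∈ M'.primesBelow, (1 - b p * (p : ℂ) ^ (-s))⁻¹) (G s)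
    have h4 : K₀ ≤ max K₀ 0 := le_max_left _ _
    rw [hK]
    linarith [h1.trans_le (min_le_right _ _)]
  -- the shift
  obtain ⟨t, ht, hclose⟩ := hM₁ M' hM' b hb hbound (max T₀ 0 + ρ + 1)
  have ht1 : ρ + 1 ≤ t := by linarith [le_max_right T₀ 0]
  -- Rouché on `|s - σ₀| < ρ`
  have hf : DiffContOnCl ℂ (fun s ↦ G s - a) (ball (σ₀ : ℂ) ρ) :=
    (hGd.sub_const a).diffContOnCl_ball (U := {s : ℂ | 1 / 2 < s.re}) hballU
  have hV : closedBall (σ₀ : ℂ) ρ ⊆ {s : ℂ | s + t * I ≠ 1} := by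
    intro s hs h
    rw [mem_closedBall, dist_eq_norm] at hs
    have him := (abs_im_le_norm (s - σ₀)).trans hs
    rw [sub_im, ofReal_im, sub_zero, abs_le] at him
    have := congrArg Complex.im h
    simp at this
    linarith [him.1]
  have hgd : DifferentiableOn ℂ (fun s ↦ riemannZeta (s + t * I) - a) {s : ℂ | s + t * I ≠ 1} :=
    fun s hs ↦ (((differentiableAt_riemannZeta hs).comp s
      (differentiableAt_id.add_const _)).sub_const a).differentiableWithinAt
  have hg : DiffContOnCl ℂ (fun s ↦ riemannZeta (s + t * I) - a) (ball (σ₀ : ℂ) ρ) :=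
    hgd.diffContOnCl_ball hV
  have hsphere : ∀ w ∈ sphere (σ₀ : ℂ) ρ,
      ‖(riemannZeta (w + t * I) - a) - (G w - a)‖ < ‖G w - a‖ := by
    intro w hw
    have hw' : w ∈ closedBall (σ₀ : ℂ) ρ := sphere_subset_closedBall hw
    have h1 := hclose w hw'
    have h2 := (happ' w hw').trans_le (min_le_left _ _)
    have h3 := hmle w hw
    rw [sub_sub_sub_cancel_right]
    calc ‖riemannZeta (w + t * I) - G w‖
        ≤ ‖riemannZeta (w + t * I) - ∏ p ∈ M'.primesBelow, (1 - b p * (p : ℂ) ^ (-w))⁻¹‖ +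
          ‖∏ p ∈ M'.primesBelow, (1 - b p * (p : ℂ) ^ (-w))⁻¹ - G w‖ :=
            norm_sub_le_norm_sub_add_norm_sub _ _ _
      _ < m / 4 + m / 4 := add_lt_add_of_le_of_lt h1 h2
      _ ≤ ‖G w - a‖ := by linarith
  obtain ⟨z, hz, hz0⟩ := exists_zero_of_norm_sub_lt_norm hρ0 hf hg (mem_ball_self hρ0)
    (by simp [hGσ₀]) hsphere
  -- the `a`-point `z + it`
  rw [mem_ball, dist_eq_norm] at hz
  have hre := (abs_re_le_norm (z - σ₀)).trans_lt hz
  have him := (abs_im_le_norm (z - σ₀)).trans_lt hz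
  rw [sub_re, ofReal_re, abs_lt] at hre
  rw [sub_im, ofReal_im, sub_zero, abs_lt] at him
  refine ⟨z + t * I, ?_, ?_, ?_, sub_eq_zero.1 hz0⟩
  · simp; linarith [hre.1]
  · simp; linarith [hre.2]
  · simp; linarith [him.1, le_max_left T₀ 0]

/-- **Discharge of the barrier `BohrDenseValues` (Bohr–Courant 1914; Titchmarsh Thm. 11.9,
Thm. 11.10), unconditionally:** conjuncts 1–2 by the Bohr–Courant density theorem and its
tail form (`BohrCourant1914_dense_holds`, `not_eventuallyConfinedOnLine'`), conjunct 3 by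
`exists_aPoint_gt`. [cite: Titchmarsh1986, Thm. 11.9 and §11.10] [cite: Steuding2007, §1.2]
[cite: BohrCourant1914, main theorem] -/
theorem BohrDenseValues_holds : BohrDenseValues :=
  BohrDenseValues_of_exists_aPoint fun _ ha _ _ hα hαβ hβ T₀ ↦ exists_aPoint_gt ha hα hαβ hβ T₀

end Literature.Barriers.RiemannHypothesis
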